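import Summits.QuantumFields.YangMills.Theorems.VirialFluxGapFixSlicePhaseModel
import Summits.QuantumFields.YangMills.Theorems.VirialFluxGapRingChartPhaseBounds
import HarnessLib

/-!
# The cubic part of the phase model along `fixSlice`: the `A₃` bound and ODDNESS in the slice coordinates
# (item (b) «hf» of the DIRECT Laplace road to ⟨stmt-QuantumFields-24204⟩ `VirialFluxGap.SharpTwistedLaplace`, parity form)

Helper module (free-hands work of width seat ym-line-sfw-p2-w2 g50, cell ym-idea-1; `--supports 24204`).  For the explicit cubic form `C(y)` of
✓`AnchorSlice.abs_ringDeficit_fixSlice_sub_chartModel_le` (letters `quatMatrix∘sliceLetterA y`, `quatMatrix∘sliceLetterB y`, transported perturbations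
`X₂, X₃, Y₂, Y₃` passed by their defining identities at the base ring `Q_s`):
* ★ `abs_chartModel_cubic_fixSlice_le` — `|C(y)| ≤ 288·L⁴·(√2 M)³` if every slice coordinate has norm `≤ M` (✓`ChartPhase.abs_chartModel_cubic_le`, w3 g56);
* ★ `chartModel_cubic_fixSlice_neg` — `C(−y) = −C(y)` (the letters are odd ✓`sliceLetterA_neg`/`sliceLetterB_neg`, the pieces are cubic
  ✓`ChartPhase.cubicPiece_neg`): the hypothesis `hCodd` of ✓`QuantitativeLaplace.window_phase_data_of_model`.
Everything here is PROVED; no definitions (namespace `Summit.QuantumFields.YangMills.Theorems.VirialFluxGap.AnchorSlice`).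

HONEST FRAMING: bookkeeping; ⟨24204⟩, ⟨24319⟩, ⟨22884⟩ and every rung stay OPEN; the Yang–Mills mass gap (Clay) is NOT touched; no summit is proved by a line.

## References
* M. Lüscher, Nucl. Phys. B219 (1983), §2. [Luscher1983]
* K. W. Breitung, *Asymptotic Approximations for Probability Integrals*, LNM 1592 (1994), Lemma 7 p. 12. [Breitung1994]
-/

set_option autoImplicit false

noncomputable section

open scoped Quaternion RealInnerProductSpace BigOperators Matrix Matrix.Norms.Frobenius
open NormedSpace
open Literature.MathematicalPhysics.QuantumFieldTheory hiding SU2 su2Quat_mul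
open Literature.MathematicalPhysics.QuantumLattice
open Literature.MathematicalPhysics.QuantumFieldTheory.Balaban1983to89.T4HaarSU2ExpChart
open Summit.QuantumFields.YangMills.Theorems.FemtoTransferGap
open Summit.QuantumFields.YangMills.Theorems.FemtoTransferGap.TT
open Summit.QuantumFields.YangMills.Theorems.FemtoTransferGap.TwoLattice
open Summit.QuantumFields.YangMills.Theorems.FemtoTransferGap.TwoLattice.Flat
open Summit.QuantumFields.YangMills.Theorems.VirialFluxGap.RingDeficit
open Summit.QuantumFields.YangMills.Theorems.VirialFluxGap.FixSplit
open Summit.QuantumFields.YangMills.Theorems.VirialFluxGap.ChartPhase (abs_chartModel_cubic_le cubicPiece_neg)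
open Summit.QuantumFields.YangMills.Theorems.QuantitativeLaplace (not_treeEdge_wrap)

namespace Summit.QuantumFields.YangMills.Theorems.VirialFluxGap.AnchorSlice

variable {L : ℕ} [NeZero L]

/-- ★ **`A₃` along the slice**: the cubic form of the phase model along `fixSlice` is at most `288·L⁴·(√2 M)³` in absolute value when every slice
coordinate has norm `≤ M`. [cite: Breitung1994, Lemma 7 p. 12] -/
theorem abs_chartModel_cubic_fixSlice_le (hL : 2 ≤ L) (z : Fin 3 → Bool) (k₀ : Fin 3) (lam : Site 3 L → SU2) (N₀ C₀ : SU2)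
    {ωC ωN ωX : EuclideanSpace ℝ (Fin 3)} (hCω : ‖ωC‖ = 1) (hNω : ‖ωN‖ = 1) (hX : imQuat ωX = imQuat ωC * imQuat ωN) (s : Fin 3 → Bool)
    (y : EuclideanSpace ℝ (Fin 3) × RestParam L ⟨(((fun _ => (-1 : ZMod L)), k₀) : Edge 3 L), not_treeEdge_wrap hL k₀⟩ 0)
    {M : ℝ} (hM0 : 0 ≤ M) (hy0 : |y.1 0| ≤ M) (hy12 : (y.1 1) ^ 2 + (y.1 2) ^ 2 ≤ M ^ 2) (hy1 : ∀ i, ‖y.2.1 i‖ ≤ M)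
    (hy2 : ∀ j e, ‖y.2.2.1 j e‖ ≤ M) (hy3 : ∀ x, ‖y.2.2.2 x‖ ≤ M)
    (X₂ X₃ : Edge 3 L → Matrix (Fin 2) (Fin 2) ℂ)
    (hX₂ : ∀ e, X₂ e = ((combFlat (fun a => centreElem (s a) * (if z a then N₀ else 1)) e : SU2) : Matrix (Fin 2) (Fin 2) ℂ) *
      quatMatrix (sliceLetterB ωC y (e.1.shift e.2)) * ((combFlat (fun a => centreElem (s a) * (if z a then N₀ else 1)) e : SU2) : Matrix (Fin 2) (Fin 2) ℂ)ᴴ)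
    (hX₃ : ∀ e, X₃ e = (((combFlat (fun a => centreElem (s a) * (if z a then N₀ else 1)) e : SU2) : Matrix (Fin 2) (Fin 2) ℂ) *
        ((lam (e.1.shift e.2) * C₀ : SU2) : Matrix (Fin 2) (Fin 2) ℂ) * ((combFlat (fun a => centreElem (s a) * (if z a then N₀ else 1)) e : SU2) : Matrix (Fin 2) (Fin 2) ℂ)ᴴ) *
        quatMatrix (sliceLetterA ωN ωX y 0 e) *
        (((combFlat (fun a => centreElem (s a) * (if z a then N₀ else 1)) e : SU2) : Matrix (Fin 2) (Fin 2) ℂ) *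
          ((lam (e.1.shift e.2) * C₀ : SU2) : Matrix (Fin 2) (Fin 2) ℂ) * ((combFlat (fun a => centreElem (s a) * (if z a then N₀ else 1)) e : SU2) : Matrix (Fin 2) (Fin 2) ℂ)ᴴ)ᴴ)
    (Y₂ Y₃ : Fin (2 * L - 1 + 1) → Plaquette 3 L → Matrix (Fin 2) (Fin 2) ℂ)
    (hY₂ : ∀ i p, Y₂ i p = ((combFlat (fun a => centreElem (s a) * (if z a then N₀ else 1)) (p.1, p.2.1.1) : SU2) : Matrix (Fin 2) (Fin 2) ℂ) *
        quatMatrix (sliceLetterA ωN ωX y i (p.1.shift p.2.1.1, p.2.1.2)) *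
        ((combFlat (fun a => centreElem (s a) * (if z a then N₀ else 1)) (p.1, p.2.1.1) : SU2) : Matrix (Fin 2) (Fin 2) ℂ)ᴴ)
    (hY₃ : ∀ i p, Y₃ i p = (((combFlat (fun a => centreElem (s a) * (if z a then N₀ else 1)) (p.1, p.2.1.1) : SU2) : Matrix (Fin 2) (Fin 2) ℂ) *
          ((combFlat (fun a => centreElem (s a) * (if z a then N₀ else 1)) (p.1.shift p.2.1.1, p.2.1.2) : SU2) : Matrix (Fin 2) (Fin 2) ℂ) *
          ((combFlat (fun a => centreElem (s a) * (if z a then N₀ else 1)) (p.1.shift p.2.1.2, p.2.1.1) : SU2) : Matrix (Fin 2) (Fin 2) ℂ)ᴴ) *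
        quatMatrix (sliceLetterA ωN ωX y i (p.1.shift p.2.1.2, p.2.1.1)) *
        (((combFlat (fun a => centreElem (s a) * (if z a then N₀ else 1)) (p.1, p.2.1.1) : SU2) : Matrix (Fin 2) (Fin 2) ℂ) *
          ((combFlat (fun a => centreElem (s a) * (if z a then N₀ else 1)) (p.1.shift p.2.1.1, p.2.1.2) : SU2) : Matrix (Fin 2) (Fin 2) ℂ) *
          ((combFlat (fun a => centreElem (s a) * (if z a then N₀ else 1)) (p.1.shift p.2.1.2, p.2.1.1) : SU2) : Matrix (Fin 2) (Fin 2) ℂ)ᴴ)ᴴ) :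
    |((∑ i : Fin (2 * L - 1), ∑ e : Edge 3 L,
            -(((quatMatrix (sliceLetterA ωN ωX y i.castSucc e) - quatMatrix (sliceLetterA ωN ωX y i.succ e)) *
              (quatMatrix (sliceLetterA ωN ωX y i.castSucc e) * quatMatrix (sliceLetterA ωN ωX y i.succ e) -
                quatMatrix (sliceLetterA ωN ωX y i.succ e) * quatMatrix (sliceLetterA ωN ωX y i.castSucc e))).trace.re / 2)) +
          (∑ e : Edge 3 L,
            ((quatMatrix (sliceLetterA ωN ωX y (Fin.last (2 * L - 1)) e) + X₂ e - X₃ e - quatMatrix (sliceLetterB ωC y e.1)) *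
              ((quatMatrix (sliceLetterA ωN ωX y (Fin.last (2 * L - 1)) e) * X₂ e - X₂ e * quatMatrix (sliceLetterA ωN ωX y (Fin.last (2 * L - 1)) e)) -
                (quatMatrix (sliceLetterA ωN ωX y (Fin.last (2 * L - 1)) e) * X₃ e - X₃ e * quatMatrix (sliceLetterA ωN ωX y (Fin.last (2 * L - 1)) e)) -
                (quatMatrix (sliceLetterA ωN ωX y (Fin.last (2 * L - 1)) e) * quatMatrix (sliceLetterB ωC y e.1) -
                  quatMatrix (sliceLetterB ωC y e.1) * quatMatrix (sliceLetterA ωN ωX y (Fin.last (2 * L - 1)) e)) - (X₂ e * X₃ e - X₃ e * X₂ e) -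
                (X₂ e * quatMatrix (sliceLetterB ωC y e.1) - quatMatrix (sliceLetterB ωC y e.1) * X₂ e) +
                (X₃ e * quatMatrix (sliceLetterB ωC y e.1) - quatMatrix (sliceLetterB ωC y e.1) * X₃ e))).trace.re / 2) +
          ∑ i : Fin (2 * L - 1 + 1), ∑ p : Plaquette 3 L,
            ((quatMatrix (sliceLetterA ωN ωX y i (p.1, p.2.1.1)) + Y₂ i p - Y₃ i p - quatMatrix (sliceLetterA ωN ωX y i (p.1, p.2.1.2))) *
              ((quatMatrix (sliceLetterA ωN ωX y i (p.1, p.2.1.1)) * Y₂ i p - Y₂ i p * quatMatrix (sliceLetterA ωN ωX y i (p.1, p.2.1.1))) -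
                (quatMatrix (sliceLetterA ωN ωX y i (p.1, p.2.1.1)) * Y₃ i p - Y₃ i p * quatMatrix (sliceLetterA ωN ωX y i (p.1, p.2.1.1))) -
                (quatMatrix (sliceLetterA ωN ωX y i (p.1, p.2.1.1)) * quatMatrix (sliceLetterA ωN ωX y i (p.1, p.2.1.2)) -
                  quatMatrix (sliceLetterA ωN ωX y i (p.1, p.2.1.2)) * quatMatrix (sliceLetterA ωN ωX y i (p.1, p.2.1.1))) -
                (Y₂ i p * Y₃ i p - Y₃ i p * Y₂ i p) -
                (Y₂ i p * quatMatrix (sliceLetterA ωN ωX y i (p.1, p.2.1.2)) - quatMatrix (sliceLetterA ωN ωX y i (p.1, p.2.1.2)) * Y₂ i p) +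
                (Y₃ i p * quatMatrix (sliceLetterA ωN ωX y i (p.1, p.2.1.2)) - quatMatrix (sliceLetterA ωN ωX y i (p.1, p.2.1.2)) * Y₃ i p))).trace.re / 2)| ≤
      288 * (L : ℝ) ^ 4 * (Real.sqrt 2 * M) ^ 3 := by
  have hC0 : (imQuat ωC).re = 0 := imQuat_re ωC
  have hN0 : (imQuat ωN).re = 0 := imQuat_re ωN
  have hX1 : ‖ωX‖ = 1 := by rw [← norm_imQuat, hX, norm_mul, norm_imQuat, norm_imQuat, hCω, hNω, mul_one]
  have hNX : ⟪ωN, ωX⟫ = 0 := by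
    rw [← inner_imQuat_imQuat, hX, real_inner_comm]; exact inner_pure_mul_right hC0 hN0
  have hAm : ∀ i e, ‖quatMatrix (sliceLetterA ωN ωX y i e)‖ ≤ Real.sqrt 2 * M := fun i e => by
    rw [frob_norm_quatMatrix]
    exact mul_le_mul_of_nonneg_left (norm_sliceLetterA_le hNω hX1 hNX y hM0 hy12 hy1 hy2 i e) (Real.sqrt_nonneg 2)
  have hBm : ∀ x, ‖quatMatrix (sliceLetterB ωC y x)‖ ≤ Real.sqrt 2 * M := fun x => by
    rw [frob_norm_quatMatrix]
    exact mul_le_mul_of_nonneg_left (norm_sliceLetterB_le hCω y hy0 hy3 x) (Real.sqrt_nonneg 2)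
  exact abs_chartModel_cubic_le
    (R := (((fun _ => combFlat (fun a => centreElem (s a) * (if z a then N₀ else 1))), fun x => lam x * C₀) :
      (Fin (2 * L - 1 + 1) → GaugeConfig 3 L SU2) × (Site 3 L → SU2)))
    (fun i e => quatMatrix (sliceLetterA ωN ωX y i e)) (fun x => quatMatrix (sliceLetterB ωC y x)) hAm hBm X₂ X₃ hX₂ hX₃ Y₂ Y₃ hY₂ hY₃

/-- ★ **The cubic form is ODD in the slice coordinates**: `C(−y) = −C(y)` (transported perturbations at `−y` and at `y` passed by their defining
identities). [cite: Breitung1994, Lemma 7 p. 12] -/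
theorem chartModel_cubic_fixSlice_neg (hL : 2 ≤ L) (z : Fin 3 → Bool) (k₀ : Fin 3) (lam : Site 3 L → SU2) (N₀ C₀ : SU2)
    (ωC ωN ωX : EuclideanSpace ℝ (Fin 3)) (s : Fin 3 → Bool)
    (y : EuclideanSpace ℝ (Fin 3) × RestParam L ⟨(((fun _ => (-1 : ZMod L)), k₀) : Edge 3 L), not_treeEdge_wrap hL k₀⟩ 0)
    (X₂ X₃ : Edge 3 L → Matrix (Fin 2) (Fin 2) ℂ)
    (hX₂ : ∀ e, X₂ e = ((combFlat (fun a => centreElem (s a) * (if z a then N₀ else 1)) e : SU2) : Matrix (Fin 2) (Fin 2) ℂ) *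
      quatMatrix (sliceLetterB ωC y (e.1.shift e.2)) * ((combFlat (fun a => centreElem (s a) * (if z a then N₀ else 1)) e : SU2) : Matrix (Fin 2) (Fin 2) ℂ)ᴴ)
    (hX₃ : ∀ e, X₃ e = (((combFlat (fun a => centreElem (s a) * (if z a then N₀ else 1)) e : SU2) : Matrix (Fin 2) (Fin 2) ℂ) *
        ((lam (e.1.shift e.2) * C₀ : SU2) : Matrix (Fin 2) (Fin 2) ℂ) * ((combFlat (fun a => centreElem (s a) * (if z a then N₀ else 1)) e : SU2) : Matrix (Fin 2) (Fin 2) ℂ)ᴴ) *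
        quatMatrix (sliceLetterA ωN ωX y 0 e) *
        (((combFlat (fun a => centreElem (s a) * (if z a then N₀ else 1)) e : SU2) : Matrix (Fin 2) (Fin 2) ℂ) *
          ((lam (e.1.shift e.2) * C₀ : SU2) : Matrix (Fin 2) (Fin 2) ℂ) * ((combFlat (fun a => centreElem (s a) * (if z a then N₀ else 1)) e : SU2) : Matrix (Fin 2) (Fin 2) ℂ)ᴴ)ᴴ)
    (Y₂ Y₃ : Fin (2 * L - 1 + 1) → Plaquette 3 L → Matrix (Fin 2) (Fin 2) ℂ)
    (hY₂ : ∀ i p, Y₂ i p = ((combFlat (fun a => centreElem (s a) * (if z a then N₀ else 1)) (p.1, p.2.1.1) : SU2) : Matrix (Fin 2) (Fin 2) ℂ) *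
        quatMatrix (sliceLetterA ωN ωX y i (p.1.shift p.2.1.1, p.2.1.2)) *
        ((combFlat (fun a => centreElem (s a) * (if z a then N₀ else 1)) (p.1, p.2.1.1) : SU2) : Matrix (Fin 2) (Fin 2) ℂ)ᴴ)
    (hY₃ : ∀ i p, Y₃ i p = (((combFlat (fun a => centreElem (s a) * (if z a then N₀ else 1)) (p.1, p.2.1.1) : SU2) : Matrix (Fin 2) (Fin 2) ℂ) *
          ((combFlat (fun a => centreElem (s a) * (if z a then N₀ else 1)) (p.1.shift p.2.1.1, p.2.1.2) : SU2) : Matrix (Fin 2) (Fin 2) ℂ) *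
          ((combFlat (fun a => centreElem (s a) * (if z a then N₀ else 1)) (p.1.shift p.2.1.2, p.2.1.1) : SU2) : Matrix (Fin 2) (Fin 2) ℂ)ᴴ) *
        quatMatrix (sliceLetterA ωN ωX y i (p.1.shift p.2.1.2, p.2.1.1)) *
        (((combFlat (fun a => centreElem (s a) * (if z a then N₀ else 1)) (p.1, p.2.1.1) : SU2) : Matrix (Fin 2) (Fin 2) ℂ) *
          ((combFlat (fun a => centreElem (s a) * (if z a then N₀ else 1)) (p.1.shift p.2.1.1, p.2.1.2) : SU2) : Matrix (Fin 2) (Fin 2) ℂ) *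
          ((combFlat (fun a => centreElem (s a) * (if z a then N₀ else 1)) (p.1.shift p.2.1.2, p.2.1.1) : SU2) : Matrix (Fin 2) (Fin 2) ℂ)ᴴ)ᴴ)
    (X₂' X₃' : Edge 3 L → Matrix (Fin 2) (Fin 2) ℂ)
    (hX₂' : ∀ e, X₂' e = ((combFlat (fun a => centreElem (s a) * (if z a then N₀ else 1)) e : SU2) : Matrix (Fin 2) (Fin 2) ℂ) *
      quatMatrix (sliceLetterB ωC (-y) (e.1.shift e.2)) * ((combFlat (fun a => centreElem (s a) * (if z a then N₀ else 1)) e : SU2) : Matrix (Fin 2) (Fin 2) ℂ)ᴴ)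
    (hX₃' : ∀ e, X₃' e = (((combFlat (fun a => centreElem (s a) * (if z a then N₀ else 1)) e : SU2) : Matrix (Fin 2) (Fin 2) ℂ) *
        ((lam (e.1.shift e.2) * C₀ : SU2) : Matrix (Fin 2) (Fin 2) ℂ) * ((combFlat (fun a => centreElem (s a) * (if z a then N₀ else 1)) e : SU2) : Matrix (Fin 2) (Fin 2) ℂ)ᴴ) *
        quatMatrix (sliceLetterA ωN ωX (-y) 0 e) *
        (((combFlat (fun a => centreElem (s a) * (if z a then N₀ else 1)) e : SU2) : Matrix (Fin 2) (Fin 2) ℂ) *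
          ((lam (e.1.shift e.2) * C₀ : SU2) : Matrix (Fin 2) (Fin 2) ℂ) * ((combFlat (fun a => centreElem (s a) * (if z a then N₀ else 1)) e : SU2) : Matrix (Fin 2) (Fin 2) ℂ)ᴴ)ᴴ)
    (Y₂' Y₃' : Fin (2 * L - 1 + 1) → Plaquette 3 L → Matrix (Fin 2) (Fin 2) ℂ)
    (hY₂' : ∀ i p, Y₂' i p = ((combFlat (fun a => centreElem (s a) * (if z a then N₀ else 1)) (p.1, p.2.1.1) : SU2) : Matrix (Fin 2) (Fin 2) ℂ) *
        quatMatrix (sliceLetterA ωN ωX (-y) i (p.1.shift p.2.1.1, p.2.1.2)) *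
        ((combFlat (fun a => centreElem (s a) * (if z a then N₀ else 1)) (p.1, p.2.1.1) : SU2) : Matrix (Fin 2) (Fin 2) ℂ)ᴴ)
    (hY₃' : ∀ i p, Y₃' i p = (((combFlat (fun a => centreElem (s a) * (if z a then N₀ else 1)) (p.1, p.2.1.1) : SU2) : Matrix (Fin 2) (Fin 2) ℂ) *
          ((combFlat (fun a => centreElem (s a) * (if z a then N₀ else 1)) (p.1.shift p.2.1.1, p.2.1.2) : SU2) : Matrix (Fin 2) (Fin 2) ℂ) *
          ((combFlat (fun a => centreElem (s a) * (if z a then N₀ else 1)) (p.1.shift p.2.1.2, p.2.1.1) : SU2) : Matrix (Fin 2) (Fin 2) ℂ)ᴴ) *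
        quatMatrix (sliceLetterA ωN ωX (-y) i (p.1.shift p.2.1.2, p.2.1.1)) *
        (((combFlat (fun a => centreElem (s a) * (if z a then N₀ else 1)) (p.1, p.2.1.1) : SU2) : Matrix (Fin 2) (Fin 2) ℂ) *
          ((combFlat (fun a => centreElem (s a) * (if z a then N₀ else 1)) (p.1.shift p.2.1.1, p.2.1.2) : SU2) : Matrix (Fin 2) (Fin 2) ℂ) *
          ((combFlat (fun a => centreElem (s a) * (if z a then N₀ else 1)) (p.1.shift p.2.1.2, p.2.1.1) : SU2) : Matrix (Fin 2) (Fin 2) ℂ)ᴴ)ᴴ) :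
    ((∑ i : Fin (2 * L - 1), ∑ e : Edge 3 L,
            -(((quatMatrix (sliceLetterA ωN ωX (-y) i.castSucc e) - quatMatrix (sliceLetterA ωN ωX (-y) i.succ e)) *
              (quatMatrix (sliceLetterA ωN ωX (-y) i.castSucc e) * quatMatrix (sliceLetterA ωN ωX (-y) i.succ e) -
                quatMatrix (sliceLetterA ωN ωX (-y) i.succ e) * quatMatrix (sliceLetterA ωN ωX (-y) i.castSucc e))).trace.re / 2)) +
          (∑ e : Edge 3 L,
            ((quatMatrix (sliceLetterA ωN ωX (-y) (Fin.last (2 * L - 1)) e) + X₂' e - X₃' e - quatMatrix (sliceLetterB ωC (-y) e.1)) *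
              ((quatMatrix (sliceLetterA ωN ωX (-y) (Fin.last (2 * L - 1)) e) * X₂' e - X₂' e * quatMatrix (sliceLetterA ωN ωX (-y) (Fin.last (2 * L - 1)) e)) -
                (quatMatrix (sliceLetterA ωN ωX (-y) (Fin.last (2 * L - 1)) e) * X₃' e - X₃' e * quatMatrix (sliceLetterA ωN ωX (-y) (Fin.last (2 * L - 1)) e)) -
                (quatMatrix (sliceLetterA ωN ωX (-y) (Fin.last (2 * L - 1)) e) * quatMatrix (sliceLetterB ωC (-y) e.1) -
                  quatMatrix (sliceLetterB ωC (-y) e.1) * quatMatrix (sliceLetterA ωN ωX (-y) (Fin.last (2 * L - 1)) e)) - (X₂' e * X₃' e - X₃' e * X₂' e) -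
                (X₂' e * quatMatrix (sliceLetterB ωC (-y) e.1) - quatMatrix (sliceLetterB ωC (-y) e.1) * X₂' e) +
                (X₃' e * quatMatrix (sliceLetterB ωC (-y) e.1) - quatMatrix (sliceLetterB ωC (-y) e.1) * X₃' e))).trace.re / 2) +
          ∑ i : Fin (2 * L - 1 + 1), ∑ p : Plaquette 3 L,
            ((quatMatrix (sliceLetterA ωN ωX (-y) i (p.1, p.2.1.1)) + Y₂' i p - Y₃' i p - quatMatrix (sliceLetterA ωN ωX (-y) i (p.1, p.2.1.2))) *
              ((quatMatrix (sliceLetterA ωN ωX (-y) i (p.1, p.2.1.1)) * Y₂' i p - Y₂' i p * quatMatrix (sliceLetterA ωN ωX (-y) i (p.1, p.2.1.1))) -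
                (quatMatrix (sliceLetterA ωN ωX (-y) i (p.1, p.2.1.1)) * Y₃' i p - Y₃' i p * quatMatrix (sliceLetterA ωN ωX (-y) i (p.1, p.2.1.1))) -
                (quatMatrix (sliceLetterA ωN ωX (-y) i (p.1, p.2.1.1)) * quatMatrix (sliceLetterA ωN ωX (-y) i (p.1, p.2.1.2)) -
                  quatMatrix (sliceLetterA ωN ωX (-y) i (p.1, p.2.1.2)) * quatMatrix (sliceLetterA ωN ωX (-y) i (p.1, p.2.1.1))) -
                (Y₂' i p * Y₃' i p - Y₃' i p * Y₂' i p) -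
                (Y₂' i p * quatMatrix (sliceLetterA ωN ωX (-y) i (p.1, p.2.1.2)) - quatMatrix (sliceLetterA ωN ωX (-y) i (p.1, p.2.1.2)) * Y₂' i p) +
                (Y₃' i p * quatMatrix (sliceLetterA ωN ωX (-y) i (p.1, p.2.1.2)) - quatMatrix (sliceLetterA ωN ωX (-y) i (p.1, p.2.1.2)) * Y₃' i p))).trace.re / 2) =
      -((∑ i : Fin (2 * L - 1), ∑ e : Edge 3 L,
            -(((quatMatrix (sliceLetterA ωN ωX y i.castSucc e) - quatMatrix (sliceLetterA ωN ωX y i.succ e)) *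
              (quatMatrix (sliceLetterA ωN ωX y i.castSucc e) * quatMatrix (sliceLetterA ωN ωX y i.succ e) -
                quatMatrix (sliceLetterA ωN ωX y i.succ e) * quatMatrix (sliceLetterA ωN ωX y i.castSucc e))).trace.re / 2)) +
          (∑ e : Edge 3 L,
            ((quatMatrix (sliceLetterA ωN ωX y (Fin.last (2 * L - 1)) e) + X₂ e - X₃ e - quatMatrix (sliceLetterB ωC y e.1)) *
              ((quatMatrix (sliceLetterA ωN ωX y (Fin.last (2 * L - 1)) e) * X₂ e - X₂ e * quatMatrix (sliceLetterA ωN ωX y (Fin.last (2 * L - 1)) e)) -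
                (quatMatrix (sliceLetterA ωN ωX y (Fin.last (2 * L - 1)) e) * X₃ e - X₃ e * quatMatrix (sliceLetterA ωN ωX y (Fin.last (2 * L - 1)) e)) -
                (quatMatrix (sliceLetterA ωN ωX y (Fin.last (2 * L - 1)) e) * quatMatrix (sliceLetterB ωC y e.1) -
                  quatMatrix (sliceLetterB ωC y e.1) * quatMatrix (sliceLetterA ωN ωX y (Fin.last (2 * L - 1)) e)) - (X₂ e * X₃ e - X₃ e * X₂ e) -
                (X₂ e * quatMatrix (sliceLetterB ωC y e.1) - quatMatrix (sliceLetterB ωC y e.1) * X₂ e) +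
                (X₃ e * quatMatrix (sliceLetterB ωC y e.1) - quatMatrix (sliceLetterB ωC y e.1) * X₃ e))).trace.re / 2) +
          ∑ i : Fin (2 * L - 1 + 1), ∑ p : Plaquette 3 L,
            ((quatMatrix (sliceLetterA ωN ωX y i (p.1, p.2.1.1)) + Y₂ i p - Y₃ i p - quatMatrix (sliceLetterA ωN ωX y i (p.1, p.2.1.2))) *
              ((quatMatrix (sliceLetterA ωN ωX y i (p.1, p.2.1.1)) * Y₂ i p - Y₂ i p * quatMatrix (sliceLetterA ωN ωX y i (p.1, p.2.1.1))) -
                (quatMatrix (sliceLetterA ωN ωX y i (p.1, p.2.1.1)) * Y₃ i p - Y₃ i p * quatMatrix (sliceLetterA ωN ωX y i (p.1, p.2.1.1))) -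
                (quatMatrix (sliceLetterA ωN ωX y i (p.1, p.2.1.1)) * quatMatrix (sliceLetterA ωN ωX y i (p.1, p.2.1.2)) -
                  quatMatrix (sliceLetterA ωN ωX y i (p.1, p.2.1.2)) * quatMatrix (sliceLetterA ωN ωX y i (p.1, p.2.1.1))) -
                (Y₂ i p * Y₃ i p - Y₃ i p * Y₂ i p) -
                (Y₂ i p * quatMatrix (sliceLetterA ωN ωX y i (p.1, p.2.1.2)) - quatMatrix (sliceLetterA ωN ωX y i (p.1, p.2.1.2)) * Y₂ i p) +
                (Y₃ i p * quatMatrix (sliceLetterA ωN ωX y i (p.1, p.2.1.2)) - quatMatrix (sliceLetterA ωN ωX y i (p.1, p.2.1.2)) * Y₃ i p))).trace.re / 2) := by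
  -- the letters are odd
  have hA : ∀ i e, quatMatrix (sliceLetterA ωN ωX (-y) i e) = -quatMatrix (sliceLetterA ωN ωX y i e) := fun i e => by
    rw [sliceLetterA_neg, Pi.neg_apply, Pi.neg_apply, quatMatrix_neg]
  have hB : ∀ x, quatMatrix (sliceLetterB ωC (-y) x) = -quatMatrix (sliceLetterB ωC y x) := fun x => by
    rw [sliceLetterB_neg, Pi.neg_apply, quatMatrix_neg]
  have hX₂n : ∀ e, X₂' e = -X₂ e := fun e => by rw [hX₂', hX₂, hB, Matrix.mul_neg, Matrix.neg_mul]
  have hX₃n : ∀ e, X₃' e = -X₃ e := fun e => by rw [hX₃', hX₃, hA, Matrix.mul_neg, Matrix.neg_mul]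
  have hY₂n : ∀ i p, Y₂' i p = -Y₂ i p := fun i p => by rw [hY₂', hY₂, hA, Matrix.mul_neg, Matrix.neg_mul]
  have hY₃n : ∀ i p, Y₃' i p = -Y₃ i p := fun i p => by rw [hY₃', hY₃, hA, Matrix.mul_neg, Matrix.neg_mul]
  -- termwise
  have hT : ∀ (i : Fin (2 * L - 1)) (e : Edge 3 L),
      -(((quatMatrix (sliceLetterA ωN ωX (-y) i.castSucc e) - quatMatrix (sliceLetterA ωN ωX (-y) i.succ e)) *
        (quatMatrix (sliceLetterA ωN ωX (-y) i.castSucc e) * quatMatrix (sliceLetterA ωN ωX (-y) i.succ e) -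
          quatMatrix (sliceLetterA ωN ωX (-y) i.succ e) * quatMatrix (sliceLetterA ωN ωX (-y) i.castSucc e))).trace.re / 2) =
      -(-(((quatMatrix (sliceLetterA ωN ωX y i.castSucc e) - quatMatrix (sliceLetterA ωN ωX y i.succ e)) *
        (quatMatrix (sliceLetterA ωN ωX y i.castSucc e) * quatMatrix (sliceLetterA ωN ωX y i.succ e) -
          quatMatrix (sliceLetterA ωN ωX y i.succ e) * quatMatrix (sliceLetterA ωN ωX y i.castSucc e))).trace.re / 2)) := by
    intro i e
    rw [hA, hA]
    have e1 : (-quatMatrix (sliceLetterA ωN ωX y i.castSucc e) - -quatMatrix (sliceLetterA ωN ωX y i.succ e)) *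
        (-quatMatrix (sliceLetterA ωN ωX y i.castSucc e) * -quatMatrix (sliceLetterA ωN ωX y i.succ e) -
          -quatMatrix (sliceLetterA ωN ωX y i.succ e) * -quatMatrix (sliceLetterA ωN ωX y i.castSucc e)) =
        -((quatMatrix (sliceLetterA ωN ωX y i.castSucc e) - quatMatrix (sliceLetterA ωN ωX y i.succ e)) *
          (quatMatrix (sliceLetterA ωN ωX y i.castSucc e) * quatMatrix (sliceLetterA ωN ωX y i.succ e) -
            quatMatrix (sliceLetterA ωN ωX y i.succ e) * quatMatrix (sliceLetterA ωN ωX y i.castSucc e))) := by noncomm_ring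
    rw [e1, Matrix.trace_neg, Complex.neg_re, neg_div]
  rw [neg_add, neg_add, ← Finset.sum_neg_distrib, ← Finset.sum_neg_distrib, ← Finset.sum_neg_distrib]
  congr 1
  · congr 1
    · refine Finset.sum_congr rfl fun i _ => ?_
      rw [← Finset.sum_neg_distrib]
      exact Finset.sum_congr rfl fun e _ => hT i e
    · refine Finset.sum_congr rfl fun e _ => ?_
      rw [hA, hX₂n, hX₃n, hB]
      exact cubicPiece_neg _ _ _ _
  · refine Finset.sum_congr rfl fun i _ => ?_
    rw [← Finset.sum_neg_distrib]
    refine Finset.sum_congr rfl fun p _ => ?_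
    rw [hA, hA, hY₂n, hY₃n]
    exact cubicPiece_neg _ _ _ _

end Summit.QuantumFields.YangMills.Theorems.VirialFluxGap.AnchorSlice
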